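/-
Copyright (c) 2026 the pub-hodgecm-mathlib formalisation cell (harness21).  Prover seat hodgecm-mathlib-K2E5-p16 (g5): Track B «K2-LIT»,
hLiu418 = stmt-HodgeConjecture-24832, ROAD Φ organ Φ6b-6 (β-shift of Shimura's `η` on `Herm₂(ℂ)`), file (3b): THE β-SHIFT IDENTITY
`etaShift g h α β = (β − 1)·η(g, h; α, β)`; 2026-09-04.
-/
import Summits.HodgeConjecture.HodgeConjecture.Theorems.K2LiuHermTwoEtaShiftConvergence      -- ★ p858395: convergence, weight bound
import Summits.HodgeConjecture.HodgeConjecture.Theorems.K2LiuHermTwoEtaShiftFibre            -- 📤 p858411: IBP on one fibre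
import HarnessLib

/-!
# Crux `HLiu418`, ROAD Φ, organ Φ6b-6 — file (3b): the β-shift identity `etaShift g h α β = (β − 1)·η(g, h; α, β)` (`re β > 1`)

Cell `hodgecm-mathlib`, crux item hLiu418 = `stmt-HodgeConjecture-24832`, route of record `HCCMUnconditional`; squad K2, LEAD F0P6-plan (g12)
(«= GO the first-order vehicle» 2026-09-04 07:40:27Z), co-dealer K2E5-plan (g6), prover K2E5-p16 (g5).  THEOREMS ONLY (no `def`, no instance,
no notation, no named-fact hypothesis, no `sorry`, default heartbeats); lane `--supports stmt-HodgeConjecture-24832 --as helper`.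

THE IDENTITY (`etaShift_eq_mul_etaTwo`).  For positive definite `g, h ∈ Herm₂(ℂ)`, every `α ∈ ℂ` and `re β > 1`:
  `etaShift g h α β = (β − 1) · η(g, h; α, β)`,
i.e. `∫_{x>h} Q_α(x) e^{−tr(gx)} det(x+h)^{α−2} det(x−h)^{β−1} dx = (β−1) ∫_{x>h} e^{−tr(gx)} det(x+h)^{α−2} det(x−h)^{β−2} dx` with the weight
`Q_α(x) = (g₀₀ − (α−2)(x+h)₁₁∕det(x+h))∕(x−h)₁₁` [one step of the continuation in `β` of Shimura1982 Thm 3.1, Case II, m = 2, for `h > 0`].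
Since the left side converges for `re β > 0` (★ `K2LiuHermTwoEtaShiftConvergence`), this carries `(β − 1)η` — hence `Γ₂(β)⁻¹η` — one unit to the left.
PROOF.  Translate `x = u + h` (★ `etaTwo_eq_integral_comp_add`, `etaShift_eq_integral_comp_add`); extend by zero to the chart `ℝ × (ℂ × ℝ)` and
write both sides as iterated integrals with the coordinate `a = u₀₀` INNERMOST (★ Mathlib `integral_prod_symm`); over `(z, b)` with `b > 0` the
`a`-fibre of the cone is the half-line `a > |z|²∕b` (`posDef_hermTwo_fibre_iff`), over `b ≤ 0` it is empty; on a fibre the two integrands are the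
functions of ★ `K2LiuHermTwoEtaShiftFibre` (`etaTwoIntegrand_add_chart`, `etaShiftIntegrand_add_chart`) and the fibre identity is
★ `fibre_integral_byParts`, whose three integrability hypotheses hold for a.e. fibre (★ Mathlib `Integrable.prod_left_ae` applied to the
three integrable functions `(β−1)·η-integrand`, `etaShiftIntegrand`, `(x−h)₁₁⁻¹·η-integrand(α, β+1)` of ★ files (2) ∕ EtaConvergence); the
positivity `det(u₀ + 2h) > 0` at the boundary point `u₀ = [[|z|²∕b, z],[z̄, b]]` of the fibre is the limit of ★ `det_add_ge` along the fibre.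
HONEST LABEL.  Count-neutral helper of the K2_Liu road; it pays no socket by itself: `HC_CM` is proved only modulo the 7 printed citations
(2 remaining named inputs: hLiu418 = `stmt-HodgeConjecture-24832`, h413 = `stmt-HodgeConjecture-24833`) until rung 0 closes.
-/

set_option autoImplicit false
-- the mandated namespace repeats the single-problem summit's segment (`HodgeConjecture.HodgeConjecture`)
set_option linter.dupNamespace false

noncomputable section

open Complex MeasureTheory Set Filter Topology
open scoped ComplexOrder ComplexConjugate

namespace Summit.HodgeConjecture.HodgeConjecture.Cruxes.HLiu418.K2LiuHermTwoEtaBetaShift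

open Summit.HodgeConjecture.HodgeConjecture.Cruxes.HLiu418.K2LiuHermTwoGammaDefs
open Summit.HodgeConjecture.HodgeConjecture.Cruxes.HLiu418.K2LiuHermTwoEtaDefs
open Summit.HodgeConjecture.HodgeConjecture.Cruxes.HLiu418.K2LiuHermTwoEtaConvergence
open Summit.HodgeConjecture.HodgeConjecture.Cruxes.HLiu418.K2LiuHermTwoEtaGrowth
open Summit.HodgeConjecture.HodgeConjecture.Cruxes.HLiu418.K2LiuHermTwoEtaShiftDefs
open Summit.HodgeConjecture.HodgeConjecture.Cruxes.HLiu418.K2LiuHermTwoEtaShiftConvergence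
open Summit.HodgeConjecture.HodgeConjecture.Cruxes.HLiu418.K2LiuHermTwoEtaShiftFibre

/-! ## Translation `x = u + h` for the shifted objects -/

/-- `etaShift g h α β = ∫_{u > 0} etaShiftIntegrand(u + h) du` for `h = hermTwo e ≥ 0`. -/
theorem etaShift_eq_integral_comp_add (g : Matrix (Fin 2) (Fin 2) ℂ) {e : ℝ × ℂ × ℝ} (he : (hermTwo e).PosSemidef) (α β : ℂ) :
    etaShift g (hermTwo e) α β = ∫ u in {c : ℝ × ℂ × ℝ | (hermTwo c).PosDef}, etaShiftIntegrand g (hermTwo e) α β (u + e) := by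
  rw [etaShift_def, etaTwoSet_eq_of_posSemidef he,
    ← (measurePreserving_add_const e).setIntegral_preimage_emb (MeasurableEquiv.addRight e).measurableEmbedding, preimage_add_const]

/-- Integrability of the translated shifted integrand on the cone (`g, h > 0`, `re β > 0`, any `α`). -/
theorem integrableOn_etaShiftIntegrand_comp_add {g : Matrix (Fin 2) (Fin 2) ℂ} (hg : g.PosDef) {e : ℝ × ℂ × ℝ} (he : (hermTwo e).PosDef)
    (α : ℂ) {β : ℂ} (hβ : 0 < β.re) :
    IntegrableOn (fun u : ℝ × ℂ × ℝ => etaShiftIntegrand g (hermTwo e) α β (u + e)) {c : ℝ × ℂ × ℝ | (hermTwo c).PosDef} := by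
  have h := integrableOn_etaShiftIntegrand hg he α hβ
  rw [etaTwoSet_eq_of_posSemidef he.posSemidef] at h
  rw [← preimage_add_const e]
  exact ((measurePreserving_add_const e).integrableOn_comp_preimage (MeasurableEquiv.addRight e).measurableEmbedding).mpr h

/-- Integrability of the translated WEIGHTED `η`-integrand on the cone (`g, h > 0`, `re β > 1`, any `α`). -/
theorem integrableOn_inv_mul_etaTwoIntegrand_comp_add {g : Matrix (Fin 2) (Fin 2) ℂ} (hg : g.PosDef) {e : ℝ × ℂ × ℝ} (he : (hermTwo e).PosDef)
    (α : ℂ) {β : ℂ} (hβ : 1 < β.re) :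
    IntegrableOn (fun u : ℝ × ℂ × ℝ => ((hermTwo (u + e) - hermTwo e) 1 1)⁻¹ * etaTwoIntegrand g (hermTwo e) α β (u + e))
      {c : ℝ × ℂ × ℝ | (hermTwo c).PosDef} := by
  have h := integrableOn_inv_mul_etaTwoIntegrand_of_posDef hg he α hβ
  rw [etaTwoSet_eq_of_posSemidef he.posSemidef] at h
  rw [← preimage_add_const e]
  exact ((measurePreserving_add_const e).integrableOn_comp_preimage (MeasurableEquiv.addRight e).measurableEmbedding).mpr h

/-! ## The integrands on a fibre, in the chart -/

/-- THE TRANSLATED `η`-INTEGRAND ON THE `a`-FIBRE over `(z, b)`: with `g = hermTwo (p, w, q)`, `h = hermTwo e`,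
`η-integrand(g, h; α, β)((a, z, b) + e) = e^{−(ap + K₁)} (aλ + K₂)^{α−2} (ab − |z|²)^{β−2}` where
`K₁ = bq + 2Re(z w̄) + τ(hg)`, `λ = b + 2e₃`, `K₂ = 2e₁(b + 2e₃) − |z + 2e₂|²` are constant along the fibre. -/
theorem etaTwoIntegrand_add_chart (d e : ℝ × ℂ × ℝ) (α β : ℂ) (a : ℝ) (z : ℂ) (b : ℝ) :
    etaTwoIntegrand (hermTwo d) (hermTwo e) α β ((a, z, b) + e) =
      cexp (-((a : ℂ) * d.1 + ((b * d.2.2 + 2 * (z * conj d.2.1).re + (e.1 * d.1 + e.2.2 * d.2.2 + 2 * (e.2.1 * conj d.2.1).re) : ℝ) : ℂ))) *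
        ((((a : ℂ) * ((b + (e.2.2 + e.2.2) : ℝ) : ℂ) + (((e.1 + e.1) * (b + (e.2.2 + e.2.2)) - normSq (z + (e.2.1 + e.2.1)) : ℝ) : ℂ)) ^ (α - 2)) *
          (((a : ℂ) * b - (normSq z : ℝ)) ^ (β - 2))) := by
  rw [etaTwoIntegrand_add, trace_hermTwo_mul_hermTwo, det_hermTwo, det_hermTwo]
  have h1 : ((((a, z, b) + e).1 * d.1 + ((a, z, b) + e).2.2 * d.2.2 + 2 * (((a, z, b) + e).2.1 * conj d.2.1).re : ℝ) : ℂ) =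
      (a : ℂ) * d.1 + ((b * d.2.2 + 2 * (z * conj d.2.1).re + (e.1 * d.1 + e.2.2 * d.2.2 + 2 * (e.2.1 * conj d.2.1).re) : ℝ) : ℂ) := by
    simp only [Prod.fst_add, Prod.snd_add, add_mul, Complex.add_re]
    push_cast
    ring
  have h2 : ((((a, z, b) + e + e).1 * ((a, z, b) + e + e).2.2 - normSq ((a, z, b) + e + e).2.1 : ℝ) : ℂ) =
      (a : ℂ) * ((b + (e.2.2 + e.2.2) : ℝ) : ℂ) + (((e.1 + e.1) * (b + (e.2.2 + e.2.2)) - normSq (z + (e.2.1 + e.2.1)) : ℝ) : ℂ) := by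
    simp only [Prod.fst_add, Prod.snd_add]
    rw [show z + e.2.1 + e.2.1 = z + (e.2.1 + e.2.1) by ring]
    push_cast
    ring
  have h3 : ((((a, z, b).1 * (a, z, b).2.2 - normSq (a, z, b).2.1 : ℝ)) : ℂ) = (a : ℂ) * b - (normSq z : ℝ) := by
    push_cast
    ring
  rw [h1, h2, h3]

/-- THE WEIGHT ON THE `a`-FIBRE: `Q_α((a, z, b) + e) = (p − (α − 2)·λ∕(aλ + K₂))∕b` with the same `λ`, `K₂` (`g = hermTwo (p, w, q)`). -/
theorem etaShiftWeight_add_chart (d e : ℝ × ℂ × ℝ) (α : ℂ) (a : ℝ) (z : ℂ) (b : ℝ) :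
    etaShiftWeight (hermTwo d) (hermTwo e) α ((a, z, b) + e) =
      ((d.1 : ℂ) - (α - 2) * ((((b + (e.2.2 + e.2.2) : ℝ) : ℂ)) /
        ((a : ℂ) * ((b + (e.2.2 + e.2.2) : ℝ) : ℂ) + (((e.1 + e.1) * (b + (e.2.2 + e.2.2)) - normSq (z + (e.2.1 + e.2.1)) : ℝ) : ℂ)))) / (b : ℂ) := by
  rw [etaShiftWeight_hermTwo, hermTwo_apply_zero_zero]
  have h1 : ((((a, z, b) + e).2.2 + e.2.2 : ℝ) : ℂ) = (((b + (e.2.2 + e.2.2) : ℝ) : ℂ)) := by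
    simp only [Prod.snd_add]
    push_cast
    ring
  have h2 : (((((a, z, b) + e).1 + e.1) * (((a, z, b) + e).2.2 + e.2.2) - normSq (((a, z, b) + e).2.1 + e.2.1) : ℝ) : ℂ) =
      (a : ℂ) * ((b + (e.2.2 + e.2.2) : ℝ) : ℂ) + (((e.1 + e.1) * (b + (e.2.2 + e.2.2)) - normSq (z + (e.2.1 + e.2.1)) : ℝ) : ℂ) := by
    simp only [Prod.fst_add, Prod.snd_add]
    rw [show z + e.2.1 + e.2.1 = z + (e.2.1 + e.2.1) by ring]
    push_cast
    ring
  have h3 : ((((a, z, b) + e).2.2 - e.2.2 : ℝ) : ℂ) = (b : ℂ) := by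
    simp only [Prod.snd_add]
    push_cast
    ring
  rw [h1, h2, h3]

/-- THE TRANSLATED SHIFTED INTEGRAND ON THE `a`-FIBRE: `Q_α · e^{−(ap+K₁)} (aλ+K₂)^{α−2} (ab − |z|²)^{(β+1)−2}`. -/
theorem etaShiftIntegrand_add_chart (d e : ℝ × ℂ × ℝ) (α β : ℂ) (a : ℝ) (z : ℂ) (b : ℝ) :
    etaShiftIntegrand (hermTwo d) (hermTwo e) α β ((a, z, b) + e) =
      ((d.1 : ℂ) - (α - 2) * ((((b + (e.2.2 + e.2.2) : ℝ) : ℂ)) /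
        ((a : ℂ) * ((b + (e.2.2 + e.2.2) : ℝ) : ℂ) + (((e.1 + e.1) * (b + (e.2.2 + e.2.2)) - normSq (z + (e.2.1 + e.2.1)) : ℝ) : ℂ)))) / (b : ℂ) *
      (cexp (-((a : ℂ) * d.1 + ((b * d.2.2 + 2 * (z * conj d.2.1).re + (e.1 * d.1 + e.2.2 * d.2.2 + 2 * (e.2.1 * conj d.2.1).re) : ℝ) : ℂ))) *
        ((((a : ℂ) * ((b + (e.2.2 + e.2.2) : ℝ) : ℂ) + (((e.1 + e.1) * (b + (e.2.2 + e.2.2)) - normSq (z + (e.2.1 + e.2.1)) : ℝ) : ℂ)) ^ (α - 2)) *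
          (((a : ℂ) * b - (normSq z : ℝ)) ^ (β + 1 - 2)))) := by
  rw [etaShiftIntegrand_apply, etaShiftWeight_add_chart, etaTwoIntegrand_add_chart]

/-- THE WEIGHTED INTEGRAND ON THE `a`-FIBRE: `b⁻¹ · e^{−(ap+K₁)} (aλ+K₂)^{α−2} (ab − |z|²)^{β−2}` (any `β`; used at `β + 1`). -/
theorem inv_mul_etaTwoIntegrand_add_chart (d e : ℝ × ℂ × ℝ) (α β : ℂ) (a : ℝ) (z : ℂ) (b : ℝ) :
    ((hermTwo ((a, z, b) + e) - hermTwo e) 1 1)⁻¹ * etaTwoIntegrand (hermTwo d) (hermTwo e) α β ((a, z, b) + e) =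
      ((b : ℂ))⁻¹ *
      (cexp (-((a : ℂ) * d.1 + ((b * d.2.2 + 2 * (z * conj d.2.1).re + (e.1 * d.1 + e.2.2 * d.2.2 + 2 * (e.2.1 * conj d.2.1).re) : ℝ) : ℂ))) *
        ((((a : ℂ) * ((b + (e.2.2 + e.2.2) : ℝ) : ℂ) + (((e.1 + e.1) * (b + (e.2.2 + e.2.2)) - normSq (z + (e.2.1 + e.2.1)) : ℝ) : ℂ)) ^ (α - 2)) *
          (((a : ℂ) * b - (normSq z : ℝ)) ^ (β - 2)))) := by
  rw [hermTwo_add_sub_apply_one_one, etaTwoIntegrand_add_chart]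

/-! ## The `a`-fibres of the cone -/

/-- THE FIBRE DESCRIPTION OF THE CONE: `[[a, z],[z̄, b]] > 0 ↔ b > 0 ∧ a > |z|²∕b`. -/
theorem posDef_hermTwo_fibre_iff (a : ℝ) (z : ℂ) (b : ℝ) : (hermTwo (a, z, b)).PosDef ↔ 0 < b ∧ normSq z / b < a := by
  rw [posDef_hermTwo_iff]
  constructor
  · rintro ⟨ha, hz⟩
    have hb : 0 < b := snd_pos_of_cone ha hz
    exact ⟨hb, (div_lt_iff₀ hb).mpr hz⟩
  · rintro ⟨hb, hz⟩
    have hz' : normSq z < a * b := (div_lt_iff₀ hb).mp hz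
    refine ⟨?_, hz'⟩
    rcases le_or_gt a 0 with ha | ha
    · have : a * b ≤ 0 := mul_nonpos_of_nonpos_of_nonneg ha hb.le
      linarith [normSq_nonneg z]
    · exact ha

/-- Over `(z, b)` with `b > 0`, the zero-extension of a function on the cone restricts to the `a`-fibre as the zero-extension from the
half-line `a > |z|²∕b`. -/
theorem indicator_cone_fibre (F : ℝ × ℂ × ℝ → ℂ) (z : ℂ) {b : ℝ} (hb : 0 < b) :
    (fun a : ℝ => {c : ℝ × ℂ × ℝ | (hermTwo c).PosDef}.indicator F (a, z, b)) = (Ioi (normSq z / b)).indicator fun a => F (a, z, b) := by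
  funext a
  by_cases ha : normSq z / b < a
  · have hmem : (a, z, b) ∈ {c : ℝ × ℂ × ℝ | (hermTwo c).PosDef} := (posDef_hermTwo_fibre_iff a z b).mpr ⟨hb, ha⟩
    rw [indicator_of_mem hmem, indicator_of_mem (show a ∈ Ioi (normSq z / b) from ha)]
  · have hnmem : (a, z, b) ∉ {c : ℝ × ℂ × ℝ | (hermTwo c).PosDef} := fun h => ha ((posDef_hermTwo_fibre_iff a z b).mp h).2
    rw [indicator_of_notMem hnmem, indicator_of_notMem (show a ∉ Ioi (normSq z / b) from ha)]

/-- Over `(z, b)` with `b ≤ 0` the `a`-fibre of the cone is empty: the zero-extension vanishes identically. -/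
theorem indicator_cone_fibre_of_nonpos (F : ℝ × ℂ × ℝ → ℂ) (z : ℂ) {b : ℝ} (hb : b ≤ 0) (a : ℝ) :
    {c : ℝ × ℂ × ℝ | (hermTwo c).PosDef}.indicator F (a, z, b) = 0 := by
  have hnmem : (a, z, b) ∉ {c : ℝ × ℂ × ℝ | (hermTwo c).PosDef} := fun h =>
    (not_lt.mpr hb) ((posDef_hermTwo_fibre_iff a z b).mp h).1
  rw [indicator_of_notMem hnmem]

/-- POSITIVITY OF `det(u + 2h)` ALONG AND AT THE END OF A FIBRE: for `h = hermTwo e > 0`, `b > 0` and `a ≥ |z|²∕b` (CLOSED fibre),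
`a·(b + 2e₃) + (2e₁(b + 2e₃) − |z + 2e₂|²) > 0` — on the open fibre this is ★ `det_add_ge` (`det(u + 2h) ≥ det(2h) > 0`), at the end point it is
its limit. -/
theorem det_add_two_pos_of_le {e : ℝ × ℂ × ℝ} (he : (hermTwo e).PosDef) (z : ℂ) {b : ℝ} (hb : 0 < b) {a : ℝ} (ha : normSq z / b ≤ a) :
    0 < a * (b + (e.2.2 + e.2.2)) + ((e.1 + e.1) * (b + (e.2.2 + e.2.2)) - normSq (z + (e.2.1 + e.2.1))) := by
  have h2e := (posDef_hermTwo_iff (e + e)).mp (by rw [hermTwo_add]; exact he.add he)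
  simp only [Prod.fst_add, Prod.snd_add] at h2e
  set δ : ℝ := (e.1 + e.1) * (e.2.2 + e.2.2) - normSq (e.2.1 + e.2.1) with hδ
  have hδ0 : 0 < δ := by rw [hδ]; linarith [h2e.2]
  -- on the open fibre: `det_add_ge`
  have hopen : ∀ a' : ℝ, normSq z / b < a' → δ ≤ a' * (b + (e.2.2 + e.2.2)) + ((e.1 + e.1) * (b + (e.2.2 + e.2.2)) - normSq (z + (e.2.1 + e.2.1))) := by
    intro a' ha'
    have hu := (posDef_hermTwo_fibre_iff a' z b).mpr ⟨hb, ha'⟩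
    rw [posDef_hermTwo_iff] at hu
    have h := det_add_ge (w := e.2.1 + e.2.1) (q := e.2.2 + e.2.2) hu.1 hu.2 h2e.1 h2e.2
    have hrw : (a' + (e.1 + e.1)) * (b + (e.2.2 + e.2.2)) - normSq (z + (e.2.1 + e.2.1)) =
        a' * (b + (e.2.2 + e.2.2)) + ((e.1 + e.1) * (b + (e.2.2 + e.2.2)) - normSq (z + (e.2.1 + e.2.1))) := by ring
    simpa only [hrw] using h
  -- at the end point: the limit along the fibre
  have hlim : Tendsto (fun a' : ℝ => a' * (b + (e.2.2 + e.2.2)) + ((e.1 + e.1) * (b + (e.2.2 + e.2.2)) - normSq (z + (e.2.1 + e.2.1))))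
      (𝓝[>] (normSq z / b)) (𝓝 (normSq z / b * (b + (e.2.2 + e.2.2)) + ((e.1 + e.1) * (b + (e.2.2 + e.2.2)) - normSq (z + (e.2.1 + e.2.1))))) :=
    ((by fun_prop : Continuous fun a' : ℝ => a' * (b + (e.2.2 + e.2.2)) +
      ((e.1 + e.1) * (b + (e.2.2 + e.2.2)) - normSq (z + (e.2.1 + e.2.1)))).tendsto _).mono_left nhdsWithin_le_nhds
  have hend : δ ≤ normSq z / b * (b + (e.2.2 + e.2.2)) + ((e.1 + e.1) * (b + (e.2.2 + e.2.2)) - normSq (z + (e.2.1 + e.2.1))) :=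
    ge_of_tendsto hlim (eventually_nhdsWithin_of_forall fun a' ha' => hopen a' ha')
  rcases ha.eq_or_lt with h | h
  · rw [← h]
    exact lt_of_lt_of_le hδ0 hend
  · exact lt_of_lt_of_le hδ0 (hopen a h)

/-! ## The head -/

/-- **THE β-SHIFT IDENTITY** (organ Φ6b-6; one step of the `β`-continuation of [Shimura1982, Thm 3.1], Case II, m = 2, `h > 0`).
For positive definite `g, h ∈ Herm₂(ℂ)`, every `α ∈ ℂ` and `re β > 1`:
`etaShift g h α β = (β − 1) · η(g, h; α, β)`, i.e.
`∫_{x>h} Q_α(x) e^{−tr(gx)} det(x+h)^{α−2} det(x−h)^{β−1} dx = (β − 1)·∫_{x>h} e^{−tr(gx)} det(x+h)^{α−2} det(x−h)^{β−2} dx`,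
`Q_α(x) = (g₀₀ − (α−2)(x+h)₁₁∕det(x+h))∕(x−h)₁₁`.  The left side converges on `ℂ × {re β > 0}` (★ `integrableOn_etaShiftIntegrand`). -/
theorem etaShift_eq_mul_etaTwo {g h : Matrix (Fin 2) (Fin 2) ℂ} (hg : g.PosDef) (hh : h.PosDef) (α : ℂ) {β : ℂ} (hβ : 1 < β.re) :
    etaShift g h α β = (β - 1) * etaTwo g h α β := by
  obtain ⟨d, rfl⟩ : ∃ d : ℝ × ℂ × ℝ, hermTwo d = g := ⟨_, hermTwo_eq_of_isHermitian hg.1⟩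
  obtain ⟨e, rfl⟩ : ∃ e : ℝ × ℂ × ℝ, hermTwo e = h := ⟨_, hermTwo_eq_of_isHermitian hh.1⟩
  have hd := (posDef_hermTwo_iff d).mp hg
  have he := (posDef_hermTwo_iff e).mp hh
  have he3 : 0 < e.2.2 := snd_pos_of_cone he.1 he.2
  have hβ0 : 0 < β.re := by linarith
  have hβ1 : 1 < (β + 1).re := by simp only [add_re, one_re]; linarith
  set S : Set (ℝ × ℂ × ℝ) := {c : ℝ × ℂ × ℝ | (hermTwo c).PosDef} with hSdef
  have hSm : MeasurableSet S := measurableSet_posDef_hermTwo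
  -- the three integrable functions on the cone
  set F₁ : ℝ × ℂ × ℝ → ℂ := fun u => (β - 1) * etaTwoIntegrand (hermTwo d) (hermTwo e) α β (u + e) with hF₁
  set F₂ : ℝ × ℂ × ℝ → ℂ := fun u => etaShiftIntegrand (hermTwo d) (hermTwo e) α β (u + e) with hF₂
  set F₃ : ℝ × ℂ × ℝ → ℂ := fun u => ((hermTwo (u + e) - hermTwo e) 1 1)⁻¹ * etaTwoIntegrand (hermTwo d) (hermTwo e) α (β + 1) (u + e)
    with hF₃
  have hI1 : IntegrableOn F₁ S := (integrableOn_etaTwoIntegrand_comp_add hg hh α hβ).const_mul (β - 1)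
  have hI2 : IntegrableOn F₂ S := integrableOn_etaShiftIntegrand_comp_add hg hh α hβ0
  have hI3 : IntegrableOn F₃ S := integrableOn_inv_mul_etaTwoIntegrand_comp_add hg hh α hβ1
  have hJ1 : Integrable (S.indicator F₁) ((volume : Measure ℝ).prod (volume : Measure (ℂ × ℝ))) := by
    rw [← Measure.volume_eq_prod]
    exact (integrable_indicator_iff hSm).mpr hI1
  have hJ2 : Integrable (S.indicator F₂) ((volume : Measure ℝ).prod (volume : Measure (ℂ × ℝ))) := by
    rw [← Measure.volume_eq_prod]
    exact (integrable_indicator_iff hSm).mpr hI2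
  have hJ3 : Integrable (S.indicator F₃) ((volume : Measure ℝ).prod (volume : Measure (ℂ × ℝ))) := by
    rw [← Measure.volume_eq_prod]
    exact (integrable_indicator_iff hSm).mpr hI3
  -- both sides as iterated integrals, `a` innermost
  rw [etaShift_eq_integral_comp_add _ hh.posSemidef, etaTwo_eq_integral_comp_add _ hh.posSemidef, ← integral_const_mul]
  change ∫ u in S, F₂ u = ∫ u in S, F₁ u
  rw [← integral_indicator hSm, ← integral_indicator hSm, Measure.volume_eq_prod, integral_prod_symm _ hJ2, integral_prod_symm _ hJ1]
  refine integral_congr_ae ?_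
  filter_upwards [hJ1.prod_left_ae, hJ2.prod_left_ae, hJ3.prod_left_ae] with w hw1 hw2 hw3
  obtain ⟨z, b⟩ := w
  rcases le_or_gt b 0 with hb | hb
  · -- empty fibre
    have h0 : ∀ (F : ℝ × ℂ × ℝ → ℂ) (a : ℝ), S.indicator F (a, z, b) = 0 := fun F a => indicator_cone_fibre_of_nonpos F z hb a
    simp only [h0, integral_zero]
  · -- the half-line fibre `a > |z|²/b`
    have hfun1 : (fun a : ℝ => S.indicator F₁ (a, z, b)) = (Ioi (normSq z / b)).indicator fun a => F₁ (a, z, b) :=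
      indicator_cone_fibre F₁ z hb
    have hfun2 : (fun a : ℝ => S.indicator F₂ (a, z, b)) = (Ioi (normSq z / b)).indicator fun a => F₂ (a, z, b) :=
      indicator_cone_fibre F₂ z hb
    have hfun3 : (fun a : ℝ => S.indicator F₃ (a, z, b)) = (Ioi (normSq z / b)).indicator fun a => F₃ (a, z, b) :=
      indicator_cone_fibre F₃ z hb
    change Integrable (fun a : ℝ => S.indicator F₁ (a, z, b)) volume at hw1
    change Integrable (fun a : ℝ => S.indicator F₂ (a, z, b)) volume at hw2
    change Integrable (fun a : ℝ => S.indicator F₃ (a, z, b)) volume at hw3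
    rw [hfun1, integrable_indicator_iff measurableSet_Ioi] at hw1
    rw [hfun2, integrable_indicator_iff measurableSet_Ioi] at hw2
    rw [hfun3, integrable_indicator_iff measurableSet_Ioi] at hw3
    change ∫ a : ℝ, S.indicator F₂ (a, z, b) = ∫ a : ℝ, S.indicator F₁ (a, z, b)
    rw [show (fun a : ℝ => S.indicator F₂ (a, z, b)) = (Ioi (normSq z / b)).indicator fun a => F₂ (a, z, b) from hfun2,
      show (fun a : ℝ => S.indicator F₁ (a, z, b)) = (Ioi (normSq z / b)).indicator fun a => F₁ (a, z, b) from hfun1,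
      integral_indicator measurableSet_Ioi, integral_indicator measurableSet_Ioi]
    -- the fibre functions in the chart
    simp only [hF₁, hF₂, hF₃, etaTwoIntegrand_add_chart, etaShiftIntegrand_add_chart, inv_mul_etaTwoIntegrand_add_chart] at hw1 hw2 hw3 ⊢
    -- the fibre identity
    have hlam : 0 ≤ b + (e.2.2 + e.2.2) := by linarith
    have hP₀ := det_add_two_pos_of_le hh z hb (le_refl (normSq z / b))
    exact (fibre_integral_byParts (p := d.1)
      (K₁ := b * d.2.2 + 2 * (z * conj d.2.1).re + (e.1 * d.1 + e.2.2 * d.2.2 + 2 * (e.2.1 * conj d.2.1).re))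
      (lam := b + (e.2.2 + e.2.2)) (K₂ := (e.1 + e.1) * (b + (e.2.2 + e.2.2)) - normSq (z + (e.2.1 + e.2.1)))
      (m := normSq z) hb hlam hP₀ α hβ hw1 hw2 hw3).symm

end Summit.HodgeConjecture.HodgeConjecture.Cruxes.HLiu418.K2LiuHermTwoEtaBetaShift

end
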